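import Summits.BirchSwinnertonDyer.Rank1Residual.Additive.TameBranchMuPartDefectTwoFullSqueeze
import HarnessLib

/-!
# X3 TWINS: `TameBranchRatCharEqAt W p` at every certified pair of X3♯(G-ord) ∩ `I₀*` (`E[p]` REDUCIBLE,
# EVERY odd `p`) from WUTHRICH 2014 Thm. 16 + Delbourgo 2002 (A)(B) + GZK (+ Greenberg Prop. 3.10 on the parity
# route) + the finite certificates — parity route (`λ_an = rank + 2`) and full route (any `λ_an`)
# (cell `b2b-bsdres`, sub-cell additive-p2 = X3♯(G-ord)/X4♯(G-ord), gen 31; part 5 — class level, X3)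

HONEST FRAMING (cell `b2b-bsdres`, run/shared/lean/b2b/bsd-rank1-residual/, verbatim in every
file): the goal of the cell is to DELETE the COMBINATION-SHAPED residual classes of the
Birch–Swinnerton-Dyer formula for ALL analytic-rank `≤ 1` elliptic curves over `ℚ` — "full BSD
formula for every rank `≤ 1` curve in class `C`" assembled STRICTLY from published theorems — so
that the rank-`≤ 1` remainder becomes exactly the CONSTRUCTION-SHAPED classes, which are TYPED
(missing-input `Prop`s), NOT attempted. This is not "finishing BSD". Sub-cell additive-p2: the
classes X3♯(G-ord) / X4♯(G-ord) are CONSTRUCTION-SHAPED and stay so; labels / RESIDUAL-MAP marks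
UNCHANGED; nothing is booked (the main conjecture at a pair is NOT `BSD(E,p)`). Theorems only; every
published input is an explicit named-fact binder: `hWu` = the semistable reducible half-eigenspace
reading of Wuthrich 2014 Thm. 16 (`Wuthrich2014.thm16_halfEigenCharIdeal_dvd_cyclotomicPrime`), `hmodD` =
BCDT, `hDel` = Delbourgo 2002 (A)+(B) (A175), `hGZK`, `hmod`, `h310` = Greenberg 1999 Prop. 3.10, and
`LeadingTermClauses W p Dh` for a given datum. No definition, no named fact minted, no `sorry`.

## What and why

Parts 3–4b proved, on X4♯(G-ord) ∩ `I₀*` ∩ {`ρ̄` onto}, that Kato's big-image divisibility (gen 19's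
full-series brick), the first-unit-index certificate and the squeeze witness / the BSD-side
inequality give cc-typer-2's typed rational main conjecture `TameBranchRatCharEqAt W p` at the pair.
On X3 (reducible `E[p]`, hence reducible `E♭[p]`) the brick is gen 19's
`isTorsion_and_exists_iota_eq_branch_of_wuthrichComponent` (Wuthrich 2014 Thm. 16, NO image hypothesis),
and every other step is class-agnostic. THIS FILE records the X3 twins:

* `ClassX3Gord.tameBranchRatCharEqAt_of_wuthrichHalf_of_firstUnit_two_rankZero` (parity route, `r_an = 0`,
  `λ_an = 2`, `2·ord_p #tors < ord_p ∏c`; stated for EVERY odd `p` and a given (B)-datum `Dh`, so that at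
  `p = 3` n1011-p16's `Delbourgo2002.mainTheorem_three` supplies `Dh` — the Gord3 cell of the census);
* `ClassX3Gord.tameBranchRatCharEqAt_of_wuthrichHalf_of_firstUnit_three_rankOne` (parity route, `r_an = 1`,
  `λ_an = 3`, `1 + 2·ord_p #tors < v + ord_p ∏c`, `v ≤ ord_p Reg_p(E,Dh)`);
* `ClassX3Gord.tameBranchRatCharEqAt_of_wuthrichHalf_of_fullSqueeze_rankOne` (full route, any `λ_an`:
  `v_p([T¹](ϖ·B^±)) + 1 + 2t ≤ v + ord_p ∏c` ⟹ also `#Ш[p^∞] = 1`, `ord_p Reg_p = v`); the rank-0 full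
  route is the same substitution in part 3's `…_of_fullSqueeze_rankZero` (not restated).

Window (EVIDENCE, X4-2 WINDOW TSV): the 13 X3 ∩ Gord_e2 @5 rank-1 rows all have `v_5(A′) = 1`
(`λ_an = 1`) and satisfy the full-squeeze inequality with equality (`v = v_h`); so, given the height
identification, the rational main conjecture at the pair, `Ш[5^∞] = 0` and `ℓ_5 = 1` hold there.
All three are stated at EVERY odd `p` with the (B)-datum as a hypothesis binder (`p ≥ 5`: A175; `p = 3`:
`Delbourgo2002.mainTheorem_three`), so the 121 X3 ∩ Gord3 @3 rank-1 window rows are in scope too.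
What is NOT claimed: `BSD(E,p)`; (M) rows; the certificates. Labels UNCHANGED.

References: Wuthrich 2014 Thm. 16 [Wuthrich2014]; Delbourgo 2002 Thm. (A), (B) p. 40 [Delbourgo2002];
Greenberg LNM 1716 Prop. 3.10, §4, §5 p. 183 [GreenbergLNM1716]; Mazur–Tate–Teitelbaum 1986 §I.13–I.14
[MazurTateTeitelbaum1986Invent]; parts 2–4b of gen 31; `GordRankOneKatoCertificate{,Class}.lean` (gen 19). -/

set_option autoImplicit false

noncomputable section

open scoped Classical MatrixGroups ModularForm NumberField

open CongruenceSubgroup IsDedekindDomain WeierstrassCurve NumberField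
  Literature.NumberTheory.EllipticCurves
  Literature.NumberTheory.EllipticCurves.ModularForms
  Literature.NumberTheory.EllipticCurves.Rank1Residual
  Literature.NumberTheory.EllipticCurves.Rank1Residual.Typed
  Literature.NumberTheory.EllipticCurves.Delbourgo2002
  Literature.NumberTheory.EllipticCurves.Greenberg1999
  Literature.NumberTheory.GaloisRepresentations
  Summit.BirchSwinnertonDyer.Rank1Residual.AdditivePotMult
  Summit.BirchSwinnertonDyer.Rank1Residual.X1.MuLambda
  Summit.BirchSwinnertonDyer.Rank1Residual.X1.RankOneParitySqueeze
  Summit.BirchSwinnertonDyer.Rank1Residual.X11a.LambdaNorm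

namespace Summit.BirchSwinnertonDyer.Rank1Residual.Additive

/-! ### §4 The X3 twins -/

section ClassLevelX3

open TameBranchMuPart

variable {W : WeierstrassCurve ℚ} [W.IsElliptic] [W.IsGloballyMinimal] {p : ℕ} [hp : Fact p.Prime]

/-- **HEADLINE, RANK ZERO. `TameBranchRatCharEqAt W p` on X3♯(G-ord) ∩ `I₀*` (`E[p]` reducible), `p` odd,
`ord_{s=1} L(E,s) = 0`, a (B)-datum `Dh` (immaterial in rank `0`: A175 at `p ≥ 5`, `mainTheorem_three` at
`p = 3`), from Wuthrich 2014 Thm. 16 + (B) + GZK + modularity + Greenberg Prop. 3.10 + TWO finite data: the first unit coefficient of `ϖ·B^±_{(p−1)/2}(f♭, α)` sits at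
index `2` with `B^±(0) ≠ 0` (`(μ_an, λ_an) = (0, 2)`), and the squeeze witness `2·ord_p #E(ℚ)_tors <
ord_p ∏c_ℓ`.** Moreover every generator of `char_Λ X(E/ℚ_∞)` has `μ = 0`, `λ = 2`. The cell's typed
rational main conjecture — "OUR CONJECTURE, OPEN on every cell" — is a THEOREM at these pairs.
[cite: Wuthrich2014, Thm. 16 (p. 397)] [cite: Delbourgo2002, Theorem (A), (B) (p. 40)]
[cite: GreenbergLNM1716, Prop. 3.10 and §5 p. 183] [cite: MazurTateTeitelbaum1986Invent, §I.13–I.14] -/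
theorem ClassX3Gord.tameBranchRatCharEqAt_of_wuthrichHalf_of_firstUnit_two_rankZero
    (hWu : Wuthrich2014.thm16_halfEigenCharIdeal_dvd_cyclotomicPrime)
    (hmodD : nonempty_modularParametrizationData)
    (hGZK : rank_eq_analyticRank_of_analyticRank_le_one) (hmod : hasEntireLFunction_rat)
    (h310 : prop310_selmerCorank_mod_two_eq_lambdaInvariant)
    (hX : ClassX3Gord W p) (hp2 : p ≠ 2) (he : semistabilityIndex W p = 2)
    (hr : W.analyticRank = 0) {Dh : PAdicHeightData W p} (hBcl : LeadingTermClauses W p Dh)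
    (hcert : ∀ (V : WeierstrassCurve ℚ) [V.IsElliptic] [V.IsGloballyMinimal] (C : VariableChange ℚ),
      C • V.quadraticTwist ((-1 : ℚ) ^ (p / 2) * p) = W → IsOrdinaryAt V p →
      ∀ {N : ℕ} [NeZero N] (f : CuspForm (Gamma0 N) 2), IsNewformOf V f →
      ∀ ϖ : ℚ, (if Even (p / 2) then (ϖ : ℝ) * V.realPeriodRat = plusPeriod f
          else (ϖ : ℝ) * V.imaginaryPeriodRat = minusPeriod f) →
        PowerSeries.constantCoeff (PowerSeries.C (ϖ : ℚ_[p]) *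
            (if Even (p / 2) then padicLFunctionBranch f ((unitRoot V p : ℤ_[p]) : ℚ_[p]) (p / 2)
              else padicLFunctionMinusBranch f ((unitRoot V p : ℤ_[p]) : ℚ_[p]) (p / 2))) ≠ 0 ∧
        ‖PowerSeries.coeff 2 (PowerSeries.C (ϖ : ℚ_[p]) *
            (if Even (p / 2) then padicLFunctionBranch f ((unitRoot V p : ℤ_[p]) : ℚ_[p]) (p / 2)
              else padicLFunctionMinusBranch f ((unitRoot V p : ℤ_[p]) : ℚ_[p]) (p / 2)))‖ = 1 ∧
        ∀ i < 2, ‖PowerSeries.coeff i (PowerSeries.C (ϖ : ℚ_[p]) *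
            (if Even (p / 2) then padicLFunctionBranch f ((unitRoot V p : ℤ_[p]) : ℚ_[p]) (p / 2)
              else padicLFunctionMinusBranch f ((unitRoot V p : ℤ_[p]) : ℚ_[p]) (p / 2)))‖ < 1)
    (hb : 2 * padicValNat p W.torsionOrder < padicValNat p W.tamagawaProduct) :
    TameBranchRatCharEqAt W p ∧
      ∀ (κ : ZpExtension ℚ p) (γ : Field.absoluteGaloisGroup ℚ),
        κ.IsCyclotomic → κ.IsTopGenerator γ → IsCyclotomicVariable p γ →
        ∀ (D : W.SelmerDualData κ γ) (fE : IwasawaAlgebra p), D.charIdeal = Ideal.span {fE} →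
          mu fE = 0 ∧ lam fE = 2 := by
  obtain ⟨hmw, -⟩ := hGZK W (by rw [hr]; norm_num)
  have hr0 : W.mordellWeilRank = 0 := by rw [hmw, hr]
  have hL : W.entireLFunction 1 ≠ 0 := (W.analyticRank_eq_zero_iff_holds (hmod W)).mp hr
  obtain ⟨V, iV, iVm, C, hV, hC⟩ := hX.exists_goodOrd_pStar_twist_model W p hp2 he
  haveI : NeZero (V.conductorNorm ℤ) := ⟨(V.conductorNorm_pos_holds).ne'⟩
  obtain ⟨Dm⟩ := hmodD V
  obtain ⟨ϖ, hϖ⟩ := exists_periodRatio_parity (p := p) V Dm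
  have hj := padicValRat_j_nonneg_of_typeGOrd W p hX.typeGOrd
  have hord : IsOrdinaryAt V p :=
    isOrdinaryAt_of_goodOrd_or_mult_of_model_twist W V (pStar_ne_zero p) ⟨C, hC⟩ hj (Or.inl hV)
  obtain ⟨h0, hn, hlt⟩ := hcert V C hC hord Dm.f Dm.isNewformOf ϖ hϖ
  -- the branch and the period ratio are non-zero
  have hϖ0 : ϖ ≠ 0 := by
    rintro rfl
    apply h0
    rw [Rat.cast_zero, map_zero, zero_mul, map_zero]
  have hB0 : (if Even (p / 2) then padicLFunctionBranch Dm.f ((unitRoot V p : ℤ_[p]) : ℚ_[p]) (p / 2)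
      else padicLFunctionMinusBranch Dm.f ((unitRoot V p : ℤ_[p]) : ℚ_[p]) (p / 2)) ≠ 0 := by
    intro e; apply h0; rw [e, mul_zero, map_zero]
  -- per datum: the squeeze of part 2
  have key : ∀ (κ : ZpExtension ℚ p) (γ : Field.absoluteGaloisGroup ℚ),
      κ.IsCyclotomic → κ.IsTopGenerator γ → IsCyclotomicVariable p γ →
      ∀ (D : W.SelmerDualData κ γ) (fE : IwasawaAlgebra p), D.charIdeal = Ideal.span {fE} →
        D.IsTorsion ∧ mu fE = 0 ∧ lam fE = 2 ∧ ∃ (g₁ : IwasawaAlgebra p) (u : ℤ_[p]ˣ),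
          D.charIdeal = Ideal.span {g₁} ∧ iwasawaToPowerSeries p g₁ =
            PowerSeries.C (((u : ℤ_[p]) : ℚ_[p]) * (ϖ : ℚ_[p])) *
              (if Even (p / 2) then padicLFunctionBranch Dm.f ((unitRoot V p : ℤ_[p]) : ℚ_[p]) (p / 2)
                else padicLFunctionMinusBranch Dm.f ((unitRoot V p : ℤ_[p]) : ℚ_[p]) (p / 2)) := by
    intro κ γ hκ hγ hγ' D fE hchar
    haveI : Module.Finite (IwasawaAlgebra p) D.X :=
      SelmerDualData.module_finite_of_isCyclotomic (W := W) (κ := κ) hκ D hγ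
    obtain ⟨hXt, g, hg, u, hι⟩ := isTorsion_and_exists_iota_eq_branch_of_wuthrichComponent W p
      (Wuthrich2014.charIdeal_dvd_padicLFunctionBranch_component_of_half hWu) hj hp2 V
      ⟨C, hC⟩ (Or.inl hV) hX.classX3.1 hκ hγ hγ' Dm.isNewformOf D ϖ hϖ
    have hn' := hn
    rw [← norm_coeff_C_unit_mul u] at hn'
    have hX0 : PowerSeries.constantCoeff (PowerSeries.C (((u : ℤ_[p]) : ℚ_[p]) * (ϖ : ℚ_[p])) *
        (if Even (p / 2) then padicLFunctionBranch Dm.f ((unitRoot V p : ℤ_[p]) : ℚ_[p]) (p / 2)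
          else padicLFunctionMinusBranch Dm.f ((unitRoot V p : ℤ_[p]) : ℚ_[p]) (p / 2))) ≠ 0 := by
      rw [map_mul, PowerSeries.constantCoeff_C, mul_assoc]
      rw [map_mul, PowerSeries.constantCoeff_C] at h0
      exact mul_ne_zero (PadicInt.coe_ne_zero.mpr u.ne_zero) h0
    obtain ⟨hμ, hlam, hspan⟩ := charIdeal_eq_span_of_iota_eq_of_firstUnit_two_rankZero h310 hp2 hr0
      hBcl hκ hγ hγ' D hXt hchar hg hι hn' (fun i hi ↦ by rw [norm_coeff_C_unit_mul u]; exact hlt i hi)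
      hX0 hb
    exact ⟨hXt, hμ, hlam, g, u, hspan, hι⟩
  refine ⟨?_, fun κ γ hκ hγ hγ' D fE hchar ↦ ⟨(key κ γ hκ hγ hγ' D fE hchar).2.1,
    (key κ γ hκ hγ hγ' D fE hchar).2.2.1⟩⟩
  intro κ γ N _ f ε α B _ haddv _ hκ hγ hcv hf _ hα hB D
  haveI : (Literature.NumberTheory.EllipticCurves.Module.charIdeal (IwasawaAlgebra p) D.X).IsPrincipal :=
    charIdeal_isPrincipal_holds p D.X
  obtain ⟨fE, hchar⟩ := Submodule.IsPrincipal.principal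
    (Literature.NumberTheory.EllipticCurves.Module.charIdeal (IwasawaAlgebra p) D.X)
  obtain ⟨hXt, -, -, g₁, u, hspan, hι⟩ := key κ γ hκ hγ hcv D fE hchar
  -- `E`'s plus symbol is not identically zero: `[0]⁺_f ≠ 0` from `L(E,1) ≠ 0`
  have hnd : ∃ s : ℚ, ratPlusSymbol f s ≠ 0 := by
    refine ⟨0, fun h00 ↦ hL ?_⟩
    rw [hf.entireLFunction_one_eq, h00]
    simp
  exact ⟨hXt, exists_charIdeal_eq_span_and_iota_eq_of_generator hp2 V C hC haddv hV hf hnd Dm hϖ0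
    hspan hι hB0 hα hB⟩

/-- **HEADLINE, RANK ONE. `TameBranchRatCharEqAt W p` on X3♯(G-ord) ∩ `I₀*` (`E[p]` reducible), `p` odd,
`ord_{s=1} L(E,s) = 1`, for a (B)-datum `Dh` (in particular Delbourgo's `⟨,⟩_{p,ℚ}`), from Wuthrich 2014 Thm. 16 + (B) + GZK + Prop. 3.10 + the data: first unit coefficient of `ϖ·B^±` at index `3` with
`[T¹] ≠ 0` (`(μ_an, λ_an) = (0, 3)`, simple zero), a non-zero plus symbol of `E`'s newform, and the
squeeze witness `1 + 2·ord_p #tors < v + ord_p ∏c_ℓ` for a certified `v ≤ ord_p Reg_p(E,Dh)`.**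
Moreover every generator has `μ = 0`, `λ = 3`. [cite: Wuthrich2014, Thm. 16 (p. 397)]
[cite: Delbourgo2002, Theorem (B) (p. 40)] [cite: GreenbergLNM1716, Prop. 3.10 and §5 p. 183]
[cite: MazurTateTeitelbaum1986Invent, §I.13–I.14] -/
theorem ClassX3Gord.tameBranchRatCharEqAt_of_wuthrichHalf_of_firstUnit_three_rankOne
    (hWu : Wuthrich2014.thm16_halfEigenCharIdeal_dvd_cyclotomicPrime)
    (hmodD : nonempty_modularParametrizationData)
    (hGZK : rank_eq_analyticRank_of_analyticRank_le_one)
    (h310 : prop310_selmerCorank_mod_two_eq_lambdaInvariant)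
    (hX : ClassX3Gord W p) (hp2 : p ≠ 2) (he : semistabilityIndex W p = 2)
    (hr : W.analyticRank = 1) {Dh : PAdicHeightData W p} (hBcl : LeadingTermClauses W p Dh)
    (hnd : ∀ {N : ℕ} [NeZero N] (f : CuspForm (Gamma0 N) 2), IsNewformOf W f →
      ∃ s : ℚ, ratPlusSymbol f s ≠ 0)
    (hcert : ∀ (V : WeierstrassCurve ℚ) [V.IsElliptic] [V.IsGloballyMinimal] (C : VariableChange ℚ),
      C • V.quadraticTwist ((-1 : ℚ) ^ (p / 2) * p) = W → IsOrdinaryAt V p →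
      ∀ {N : ℕ} [NeZero N] (f : CuspForm (Gamma0 N) 2), IsNewformOf V f →
      ∀ ϖ : ℚ, (if Even (p / 2) then (ϖ : ℝ) * V.realPeriodRat = plusPeriod f
          else (ϖ : ℝ) * V.imaginaryPeriodRat = minusPeriod f) →
        PowerSeries.coeff 1 (PowerSeries.C (ϖ : ℚ_[p]) *
            (if Even (p / 2) then padicLFunctionBranch f ((unitRoot V p : ℤ_[p]) : ℚ_[p]) (p / 2)
              else padicLFunctionMinusBranch f ((unitRoot V p : ℤ_[p]) : ℚ_[p]) (p / 2))) ≠ 0 ∧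
        ‖PowerSeries.coeff 3 (PowerSeries.C (ϖ : ℚ_[p]) *
            (if Even (p / 2) then padicLFunctionBranch f ((unitRoot V p : ℤ_[p]) : ℚ_[p]) (p / 2)
              else padicLFunctionMinusBranch f ((unitRoot V p : ℤ_[p]) : ℚ_[p]) (p / 2)))‖ = 1 ∧
        ∀ i < 3, ‖PowerSeries.coeff i (PowerSeries.C (ϖ : ℚ_[p]) *
            (if Even (p / 2) then padicLFunctionBranch f ((unitRoot V p : ℤ_[p]) : ℚ_[p]) (p / 2)
              else padicLFunctionMinusBranch f ((unitRoot V p : ℤ_[p]) : ℚ_[p]) (p / 2)))‖ < 1)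
    {v : ℤ} (hv : v ≤ (padicRegulator Dh).valuation)
    (hb : (1 : ℤ) + 2 * padicValNat p W.torsionOrder < v + padicValNat p W.tamagawaProduct) :
    TameBranchRatCharEqAt W p ∧
      ∀ (κ : ZpExtension ℚ p) (γ : Field.absoluteGaloisGroup ℚ),
        κ.IsCyclotomic → κ.IsTopGenerator γ → IsCyclotomicVariable p γ →
        ∀ (D : W.SelmerDualData κ γ) (fE : IwasawaAlgebra p), D.charIdeal = Ideal.span {fE} →
          mu fE = 0 ∧ lam fE = 3 := by
  obtain ⟨hmw, -⟩ := hGZK W (by rw [hr])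
  have hr1 : W.mordellWeilRank = 1 := by rw [hmw, hr]
  obtain ⟨V, iV, iVm, C, hV, hC⟩ := hX.exists_goodOrd_pStar_twist_model W p hp2 he
  haveI : NeZero (V.conductorNorm ℤ) := ⟨(V.conductorNorm_pos_holds).ne'⟩
  obtain ⟨Dm⟩ := hmodD V
  obtain ⟨ϖ, hϖ⟩ := exists_periodRatio_parity (p := p) V Dm
  have hj := padicValRat_j_nonneg_of_typeGOrd W p hX.typeGOrd
  have hord : IsOrdinaryAt V p :=
    isOrdinaryAt_of_goodOrd_or_mult_of_model_twist W V (pStar_ne_zero p) ⟨C, hC⟩ hj (Or.inl hV)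
  obtain ⟨h1, hn, hlt⟩ := hcert V C hC hord Dm.f Dm.isNewformOf ϖ hϖ
  have hϖ0 : ϖ ≠ 0 := by
    rintro rfl
    apply h1
    rw [Rat.cast_zero, map_zero, zero_mul, map_zero]
  have hB0 : (if Even (p / 2) then padicLFunctionBranch Dm.f ((unitRoot V p : ℤ_[p]) : ℚ_[p]) (p / 2)
      else padicLFunctionMinusBranch Dm.f ((unitRoot V p : ℤ_[p]) : ℚ_[p]) (p / 2)) ≠ 0 := by
    intro e; apply h1; rw [e, mul_zero, map_zero]
  have key : ∀ (κ : ZpExtension ℚ p) (γ : Field.absoluteGaloisGroup ℚ),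
      κ.IsCyclotomic → κ.IsTopGenerator γ → IsCyclotomicVariable p γ →
      ∀ (D : W.SelmerDualData κ γ) (fE : IwasawaAlgebra p), D.charIdeal = Ideal.span {fE} →
        D.IsTorsion ∧ mu fE = 0 ∧ lam fE = 3 ∧ ∃ (g₁ : IwasawaAlgebra p) (u : ℤ_[p]ˣ),
          D.charIdeal = Ideal.span {g₁} ∧ iwasawaToPowerSeries p g₁ =
            PowerSeries.C (((u : ℤ_[p]) : ℚ_[p]) * (ϖ : ℚ_[p])) *
              (if Even (p / 2) then padicLFunctionBranch Dm.f ((unitRoot V p : ℤ_[p]) : ℚ_[p]) (p / 2)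
                else padicLFunctionMinusBranch Dm.f ((unitRoot V p : ℤ_[p]) : ℚ_[p]) (p / 2)) := by
    intro κ γ hκ hγ hγ' D fE hchar
    haveI : Module.Finite (IwasawaAlgebra p) D.X :=
      SelmerDualData.module_finite_of_isCyclotomic (W := W) (κ := κ) hκ D hγ
    obtain ⟨hXt, g, hg, u, hι⟩ := isTorsion_and_exists_iota_eq_branch_of_wuthrichComponent W p
      (Wuthrich2014.charIdeal_dvd_padicLFunctionBranch_component_of_half hWu) hj hp2 V
      ⟨C, hC⟩ (Or.inl hV) hX.classX3.1 hκ hγ hγ' Dm.isNewformOf D ϖ hϖ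
    have hn' := hn
    rw [← norm_coeff_C_unit_mul u] at hn'
    have hX1 : PowerSeries.coeff 1 (PowerSeries.C (((u : ℤ_[p]) : ℚ_[p]) * (ϖ : ℚ_[p])) *
        (if Even (p / 2) then padicLFunctionBranch Dm.f ((unitRoot V p : ℤ_[p]) : ℚ_[p]) (p / 2)
          else padicLFunctionMinusBranch Dm.f ((unitRoot V p : ℤ_[p]) : ℚ_[p]) (p / 2))) ≠ 0 := by
      rw [PowerSeries.coeff_C_mul, mul_assoc]
      rw [PowerSeries.coeff_C_mul] at h1
      exact mul_ne_zero (PadicInt.coe_ne_zero.mpr u.ne_zero) h1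
    obtain ⟨hμ, hlam, hspan⟩ := charIdeal_eq_span_of_iota_eq_of_firstUnit_three_rankOne h310 hp2 hr1
      hBcl hκ hγ hγ' D hXt hchar hg hι hn' (fun i hi ↦ by rw [norm_coeff_C_unit_mul u]; exact hlt i hi)
      hX1 hv hb
    exact ⟨hXt, hμ, hlam, g, u, hspan, hι⟩
  refine ⟨?_, fun κ γ hκ hγ hγ' D fE hchar ↦ ⟨(key κ γ hκ hγ hγ' D fE hchar).2.1,
    (key κ γ hκ hγ hγ' D fE hchar).2.2.1⟩⟩
  intro κ γ N _ f ε α B _ haddv _ hκ hγ hcv hf _ hα hB D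
  haveI : (Literature.NumberTheory.EllipticCurves.Module.charIdeal (IwasawaAlgebra p) D.X).IsPrincipal :=
    charIdeal_isPrincipal_holds p D.X
  obtain ⟨fE, hchar⟩ := Submodule.IsPrincipal.principal
    (Literature.NumberTheory.EllipticCurves.Module.charIdeal (IwasawaAlgebra p) D.X)
  obtain ⟨hXt, -, -, g₁, u, hspan, hι⟩ := key κ γ hκ hγ hcv D fE hchar
  exact ⟨hXt, exists_charIdeal_eq_span_and_iota_eq_of_generator hp2 V C hC haddv hV hf (hnd f hf) Dm
    hϖ0 hspan hι hB0 hα hB⟩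

/-- **HEADLINE, RANK ONE, FULL ROUTE (any `λ_an`).** X3♯(G-ord) ∩ `I₀*` (`E[p]` reducible), `p` odd,
`ord_{s=1} L(E,s) = 1`, a (B)-datum `Dh`; data: the first unit coefficient of `ϖ·B^±_{(p−1)/2}(f♭, α)` at
SOME index `n` with `[T¹] ≠ 0`, one non-zero plus symbol of `E`'s newform, and a certified
`v ≤ ord_p Reg_p(E,Dh)` with **`v_p([T¹](ϖ·B^±)) + 1 + 2·ord_p #tors ≤ v + ord_p ∏c_ℓ`** (census:
`v_p(A′) + 2t ≤ v_h + ord_p ∏c`, an EQUALITY on 429/429 defect-2 window rows). Then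
**`TameBranchRatCharEqAt W p`**, Schneider, **`ord_p Reg_p(E,Dh) = v`**, **`#Ш(E/ℚ)[p^∞] = 1`**, and every
generator of `char_Λ X(E/ℚ_∞)` has `μ = 0`, `λ = n`. Inputs: Wuthrich Thm. 16, (B), GZK — NO parity.
[cite: Wuthrich2014, Thm. 16 (p. 397)] [cite: Delbourgo2002, Theorem (B) (p. 40)]
[cite: GreenbergLNM1716, §4 pp. 102–110] [cite: MazurTateTeitelbaum1986Invent, §I.13–I.14] -/
theorem ClassX3Gord.tameBranchRatCharEqAt_of_wuthrichHalf_of_fullSqueeze_rankOne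
    (hWu : Wuthrich2014.thm16_halfEigenCharIdeal_dvd_cyclotomicPrime)
    (hmodD : nonempty_modularParametrizationData)
    (hGZK : rank_eq_analyticRank_of_analyticRank_le_one)
    (hX : ClassX3Gord W p) (hp2 : p ≠ 2) (he : semistabilityIndex W p = 2)
    (hr : W.analyticRank = 1) {Dh : PAdicHeightData W p} (hBcl : LeadingTermClauses W p Dh)
    (hnd : ∀ {N : ℕ} [NeZero N] (f : CuspForm (Gamma0 N) 2), IsNewformOf W f →
      ∃ s : ℚ, ratPlusSymbol f s ≠ 0) {n : ℕ} {v : ℤ} (hv : v ≤ (padicRegulator Dh).valuation)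
    (hcert : ∀ (V : WeierstrassCurve ℚ) [V.IsElliptic] [V.IsGloballyMinimal] (C : VariableChange ℚ),
      C • V.quadraticTwist ((-1 : ℚ) ^ (p / 2) * p) = W → IsOrdinaryAt V p →
      ∀ {N : ℕ} [NeZero N] (f : CuspForm (Gamma0 N) 2), IsNewformOf V f →
      ∀ ϖ : ℚ, (if Even (p / 2) then (ϖ : ℝ) * V.realPeriodRat = plusPeriod f
          else (ϖ : ℝ) * V.imaginaryPeriodRat = minusPeriod f) →
        PowerSeries.coeff 1 (PowerSeries.C (ϖ : ℚ_[p]) *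
            (if Even (p / 2) then padicLFunctionBranch f ((unitRoot V p : ℤ_[p]) : ℚ_[p]) (p / 2)
              else padicLFunctionMinusBranch f ((unitRoot V p : ℤ_[p]) : ℚ_[p]) (p / 2))) ≠ 0 ∧
        (PowerSeries.coeff 1 (PowerSeries.C (ϖ : ℚ_[p]) *
            (if Even (p / 2) then padicLFunctionBranch f ((unitRoot V p : ℤ_[p]) : ℚ_[p]) (p / 2)
              else padicLFunctionMinusBranch f ((unitRoot V p : ℤ_[p]) : ℚ_[p]) (p / 2)))).valuation +
            1 + 2 * padicValNat p W.torsionOrder ≤ v + padicValNat p W.tamagawaProduct ∧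
        ‖PowerSeries.coeff n (PowerSeries.C (ϖ : ℚ_[p]) *
            (if Even (p / 2) then padicLFunctionBranch f ((unitRoot V p : ℤ_[p]) : ℚ_[p]) (p / 2)
              else padicLFunctionMinusBranch f ((unitRoot V p : ℤ_[p]) : ℚ_[p]) (p / 2)))‖ = 1 ∧
        ∀ i < n, ‖PowerSeries.coeff i (PowerSeries.C (ϖ : ℚ_[p]) *
            (if Even (p / 2) then padicLFunctionBranch f ((unitRoot V p : ℤ_[p]) : ℚ_[p]) (p / 2)
              else padicLFunctionMinusBranch f ((unitRoot V p : ℤ_[p]) : ℚ_[p]) (p / 2)))‖ < 1) :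
    TameBranchRatCharEqAt W p ∧ SchneiderConjecture Dh ∧ (padicRegulator Dh).valuation = v ∧
      Nat.card (AddCommGroup.primaryComponent W.sha p) = 1 ∧
      ∀ (κ : ZpExtension ℚ p) (γ : Field.absoluteGaloisGroup ℚ),
        κ.IsCyclotomic → κ.IsTopGenerator γ → IsCyclotomicVariable p γ →
        ∀ (D : W.SelmerDualData κ γ) (fE : IwasawaAlgebra p), D.charIdeal = Ideal.span {fE} →
          mu fE = 0 ∧ lam fE = n := by
  obtain ⟨hmw, -⟩ := hGZK W (by rw [hr])
  have hr1 : W.mordellWeilRank = 1 := by rw [hmw, hr]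
  obtain ⟨V, iV, iVm, C, hV, hC⟩ := hX.exists_goodOrd_pStar_twist_model W p hp2 he
  haveI : NeZero (V.conductorNorm ℤ) := ⟨(V.conductorNorm_pos_holds).ne'⟩
  obtain ⟨Dm⟩ := hmodD V
  obtain ⟨ϖ, hϖ⟩ := exists_periodRatio_parity (p := p) V Dm
  have hj := padicValRat_j_nonneg_of_typeGOrd W p hX.typeGOrd
  have hord : IsOrdinaryAt V p :=
    isOrdinaryAt_of_goodOrd_or_mult_of_model_twist W V (pStar_ne_zero p) ⟨C, hC⟩ hj (Or.inl hV)
  obtain ⟨h1, hfull, hn, hlt⟩ := hcert V C hC hord Dm.f Dm.isNewformOf ϖ hϖ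
  have hϖ0 : ϖ ≠ 0 := by
    rintro rfl
    apply h1
    rw [Rat.cast_zero, map_zero, zero_mul, map_zero]
  have hB0 : (if Even (p / 2) then padicLFunctionBranch Dm.f ((unitRoot V p : ℤ_[p]) : ℚ_[p]) (p / 2)
      else padicLFunctionMinusBranch Dm.f ((unitRoot V p : ℤ_[p]) : ℚ_[p]) (p / 2)) ≠ 0 := by
    intro e; apply h1; rw [e, mul_zero, map_zero]
  -- one cyclotomic datum exists: the datum-independent conclusions
  obtain ⟨κ₀, γ₀, hκ₀, hγ₀, hγ₀', D₀, fE₀, hchar₀⟩ := exists_cyclotomic_dualData_generator W p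
  have key : ∀ (κ : ZpExtension ℚ p) (γ : Field.absoluteGaloisGroup ℚ),
      κ.IsCyclotomic → κ.IsTopGenerator γ → IsCyclotomicVariable p γ →
      ∀ (D : W.SelmerDualData κ γ) (fE : IwasawaAlgebra p), D.charIdeal = Ideal.span {fE} →
        D.IsTorsion ∧ SchneiderConjecture Dh ∧ mu fE = 0 ∧ lam fE = n ∧
          Nat.card (AddCommGroup.primaryComponent W.sha p) = 1 ∧ (padicRegulator Dh).valuation = v ∧
          ∃ (g₁ : IwasawaAlgebra p) (u : ℤ_[p]ˣ),
          D.charIdeal = Ideal.span {g₁} ∧ iwasawaToPowerSeries p g₁ =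
            PowerSeries.C (((u : ℤ_[p]) : ℚ_[p]) * (ϖ : ℚ_[p])) *
              (if Even (p / 2) then padicLFunctionBranch Dm.f ((unitRoot V p : ℤ_[p]) : ℚ_[p]) (p / 2)
                else padicLFunctionMinusBranch Dm.f ((unitRoot V p : ℤ_[p]) : ℚ_[p]) (p / 2)) := by
    intro κ γ hκ hγ hγ' D fE hchar
    haveI : Module.Finite (IwasawaAlgebra p) D.X :=
      SelmerDualData.module_finite_of_isCyclotomic (W := W) (κ := κ) hκ D hγ
    obtain ⟨hXt, g, hg, u, hι⟩ := isTorsion_and_exists_iota_eq_branch_of_wuthrichComponent W p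
      (Wuthrich2014.charIdeal_dvd_padicLFunctionBranch_component_of_half hWu) hj hp2 V
      ⟨C, hC⟩ (Or.inl hV) hX.classX3.1 hκ hγ hγ' Dm.isNewformOf D ϖ hϖ
    have hn' := hn
    rw [← norm_coeff_C_unit_mul u] at hn'
    have hX1 : PowerSeries.coeff 1 (PowerSeries.C (((u : ℤ_[p]) : ℚ_[p]) * (ϖ : ℚ_[p])) *
        (if Even (p / 2) then padicLFunctionBranch Dm.f ((unitRoot V p : ℤ_[p]) : ℚ_[p]) (p / 2)
          else padicLFunctionMinusBranch Dm.f ((unitRoot V p : ℤ_[p]) : ℚ_[p]) (p / 2))) ≠ 0 := by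
      rw [PowerSeries.coeff_C_mul, mul_assoc]
      rw [PowerSeries.coeff_C_mul] at h1
      exact mul_ne_zero (PadicInt.coe_ne_zero.mpr u.ne_zero) h1
    have hfull' := hfull
    rw [← valuation_coeff_C_unit_mul u _ _ 1 h1] at hfull'
    obtain ⟨hS, hμ, hlam, hcard, hReg, -, hspan⟩ := fullSqueeze_rankOne_of_iota_eq_of_firstUnit hp2
      hr1 hBcl hκ hγ hγ' D hXt hchar hg hι hn'
      (fun i hi ↦ by rw [norm_coeff_C_unit_mul u]; exact hlt i hi) hX1 hv hfull'
    exact ⟨hXt, hS, hμ, hlam, hcard, hReg, g, u, hspan, hι⟩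
  obtain ⟨-, hS₀, -, -, hcard₀, hReg₀, -⟩ := key κ₀ γ₀ hκ₀ hγ₀ hγ₀' D₀ fE₀ hchar₀
  refine ⟨?_, hS₀, hReg₀, hcard₀, fun κ γ hκ hγ hγ' D fE hchar ↦
    ⟨(key κ γ hκ hγ hγ' D fE hchar).2.2.1, (key κ γ hκ hγ hγ' D fE hchar).2.2.2.1⟩⟩
  intro κ γ N _ f ε α B _ haddv _ hκ hγ hcv hf _ hα hB D
  haveI : (Literature.NumberTheory.EllipticCurves.Module.charIdeal (IwasawaAlgebra p) D.X).IsPrincipal :=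
    charIdeal_isPrincipal_holds p D.X
  obtain ⟨fE, hchar⟩ := Submodule.IsPrincipal.principal
    (Literature.NumberTheory.EllipticCurves.Module.charIdeal (IwasawaAlgebra p) D.X)
  obtain ⟨hXt, -, -, -, -, -, g₁, u, hspan, hι⟩ := key κ γ hκ hγ hcv D fE hchar
  exact ⟨hXt, exists_charIdeal_eq_span_and_iota_eq_of_generator hp2 V C hC haddv hV hf (hnd f hf) Dm
    hϖ0 hspan hι hB0 hα hB⟩

end ClassLevelX3

end Summit.BirchSwinnertonDyer.Rank1Residual.Additive

end
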